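import Summits.Ventures.QEC.Census.CertChunks
import Summits.Ventures.QEC.Census.HB.HB40.KernelZ01
import HarnessLib

/-!
# `HB40` — KERNEL-tier lower-bound replay, side Z: assembly (emitted by qec-search-7)

From the leaf files `KernelZ01 … KernelZ01` (packed chunks, each `decide +kernel`) this file assembles, by
first-order terms only (lemmas of `Census/CertChunks.lean`: `reaches_chunk1_of_chunk2`, `reaches_origin_of_chunk1`,
`forall_lt_append`, `forall_lt_single`, `forall_of_chunk1R`, `forall_of_chunk2R`), the statement

  `Reaches (leafTest [3146753, 206158495745, 6293506, 412316991490, 12587012, 824633982980, 25174024, 550830080008, 3221226512, 50348048, 6442453024, 100696096, 12884906048, 201392192, 25769812096, 402784384, 51539624192, 805568768, 103079248384, 538444288]) (posList 40 cert.HX) 5 0 0`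

i.e. the bruteforce replay of budget `5` over all 40 positions of side Z reached every support of weight `≤ 5` with
its true syndrome and found it nonzero-syndrome, empty, or allow-listed (= what `scan … = true` would give in one
evaluation, `CertScan.reaches_of_scan`; the soundness step to `dZ = 6` is type-10's, file `HB/HB40/Distance.lean`).
Chunk plan: first positions `i < 0` split at level 2 (second position), `i ≥ 0` at level 1; cap 200000 end points per
kernel evaluation; 5 evaluations; 760098 end points in total. Tier KERNEL (CERTIFIED).
-/

namespace Summit.Ventures.QEC.Census.HB40

/-- **Side Z of `HB40`, tier KERNEL**: the bruteforce replay of budget 5 over all 40 positions reaches every support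
of weight `≤ 5` (nonzero syndrome, or empty, or allow-listed). -/
theorem reachesZ : Reaches (leafTest [3146753, 206158495745, 6293506, 412316991490, 12587012, 824633982980, 25174024, 550830080008, 3221226512, 50348048, 6442453024, 100696096, 12884906048, 201392192, 25769812096, 402784384, 51539624192, 805568768, 103079248384, 538444288]) (posList 40 cert.HX) 5 0 0 :=
  reaches_origin_of_chunk1 40 (by decide +kernel) (by decide +kernel)
    (forall_lt_append (forall_lt_append (forall_lt_append (forall_lt_append (forall_lt_append (forall_lt_zero) (forall_of_chunk1R kZ1_0)) (forall_of_chunk1R kZ1_2)) (forall_of_chunk1R kZ1_4)) (forall_of_chunk1R kZ1_7)) (forall_of_chunk1R kZ1_13))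

end Summit.Ventures.QEC.Census.HB40
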